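import Summits.ABC.IUTFork.Cor312LicenceExactOrdersMSingleton
import Summits.ABC.IUTFork.Cor312LicenceExactContentMGenuine
import HarnessLib

/-!
# [IUTchIII] Cor. 3.12, Step (xi-f): the orders-form refutation of the licence at the M-LEVEL setting of the datum's OWN
# ideles — one integer `m_q` per bad member (`‖t_{q,v̲}‖ = ‖ϖ‖^{m_q}`, `‖t_{Θ,i+1,v̲}‖ = ‖t_{q,v̲}‖^{(i+1)²}`)

PROOF-ONLY record file (D-0012; no definitions, no `Prop` facts, no instances) of the abc-iut cell (WAVE-5 prover seat
abc-iut-w5-d166, gen 7; D-0079 R-W lane U, row «W:M-U2-ORDERS», part 3 of 3 over `Cor312LicenceExactOrdersM` (p466948) /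
`Cor312LicenceExactOrdersMSingleton`: the instantiation at
the Θ-ideles `tOfIdeleData D r` / q-ideles `tqM … r` READ OFF a Θ-volume datum's idele data `r` (abc-iut-w5-d033), i.e. at the EXACT
setting of the M-line certificates of record — abc-iut-C-cert-3 `Conditional.abc_of_SH_v11M_window` p445989 / `…_szpiroBadAll`
p453767 (binder `hSHw`), `abc_of_SH_orNum_M_szpiroBad(_hregBad)` p451523 / p453684 (binder `hNumOffBad_M`), with
`r := ideleDataOf T.D T.isVolumeInputOf`). TAKES NO SIDE on [IUTchIII] Cor. 3.12 (kurims manuscript p. 173–174; Step (xi-f) p. 184)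
or on any author.

* `norm_tOfIdeleData_eq_zpow_of_norm_tqM` — `‖t_{q,x₀}‖ = ‖ϖ‖^{m_q} ⟹ ‖t_{Θ,i,x₀}‖ = ‖ϖ‖^{(i+1)²·m_q}` (p459746 / gen-5
  `norm_tThetaM_eq_norm_tqM_pow`, Dupuy–Hilado (3.4) `P_{Θ,j} = j²·P_q`);
* **`not_licence_settingPrVolSharpM_tOfIdeleData_of_orders`** — ANY local type: at ONE member `x₀` with uniformiser `ϖ`, `d = D/e`,
  radii `‖cin₀‖ = ‖ϖ‖^{R_in}`, `‖cout₀‖ = ‖ϖ‖^{R_out}`: `m_q < e·(((i+1)²·m_q − (i+1)·D − (i+2)·R_in) / e) + (i+2)·R_out ⟹ ¬ Licence`;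
* **`not_licence_settingPrVolSharpM_tOfIdeleData_of_tame_orders`** — TAME member (`p_u > 2`, `e ≤ p_u − 2`):
  `m_q < e·(((i+1)²·m_q − 1)/e) + 1 − (i+1)·(e − 1) ⟹ ¬ Licence` — the M twin, refutation direction, of abc-iut-w5-d009's
  genuine-`K` tame decider `licence_settingPrVolSharp_pilotDataOfK_iff_of_tame` (p449282).
* **`licence_settingPrVolSharpM_tOfIdeleData_iff_orders_of_forall_eq`** — SINGLETON fibres everywhere (e.g. `F_mod = ℚ`): the licence at
  the own-ideles setting ⟺ `∀ u i, e_u·(((i+1)²·m_q(u) − (i+1)·D_u − (i+2)·R_in(u)) / e_u) + (i+2)·R_out(u) ≤ m_q(u)` — EXACT, both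
  verdicts; the M analogue of abc-iut-w5-d009's K-level tame decider (there tame only, `R_in = R_out = 1`; here any local type).
At a BAD member the q-norm is `‖t_{q,v̲}‖ = p^{ord_v(j_E)/(2l·e_v)}` (gen-5 `norm_tqM_eq_rpow_ord_jMod`), so `m_q` is the integer
`−e(v̲|v)·ord_v(j_E)/(2l)` whenever that quotient is integral ([IUTchI] Ex. 3.2 (iv): `q_v = q̲_v^{2l}` in `K_{v̲}`); the integrality
is the consumer's input here (hypothesis `hq`), nothing about it is claimed.
HONEST SCOPE as in parts 1–2: necessity at every datum, the converse ONLY at singleton fibres (no converse at mixed summands); the licence is a STRONGER-THAN-PRINT set-level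
reading of Step (xi-f) (ADJUDICATION-SPEC §2 (G1′)); OUR sharp containers and typed (Ind1)/(Ind2)/(Ind3); nothing about the printed
GLOBAL inequality or the NUMBER-level `Cor22.Cor312AtDatum`; refuted-as-typed ≠ refuted-in-print.
[cite: Mochizuki2012, IUTchIII Cor. 3.12 p. 173–174, Step (xi-f) p. 184; IUTchIV Prop. 1.2 (i)(ii) p. 10; IUTchI Def. 3.1 (e) p. 62,
Ex. 3.2 (iv) p. 67] [cite: DupuyHilado2025, §3.3, §3.4, §3.9, §4.9, §4.12] [cite: NeukirchANT1999, Ch. II (5.5)]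
[claim: Mochizuki2012, status: disputed] for every IUT sentence quoted. typed ≠ proved (these: proved); instantiated ≠ endorsed.
-/

noncomputable section

open Set Function NumberField IsDedekindDomain
open scoped Pointwise

/-! ## The datum's OWN ideles: one integer `m_q` per bad member decides the refutation -/

namespace Summit.ABC.IUTFork.Thm311.Real

open Cor312 Cor312Vol Literature.IUT.LogThetaLattice Literature.IUT.LogVolume Literature.IUT.HodgeTheaters
  Literature.NumberTheory.NumberFields Literature.NumberTheory.GaloisRepresentations.Ultrametric

variable {F K Fbar : Type} [Field F] [NumberField F] [Field K] [NumberField K] [Algebra F K]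
  [Field Fbar] [Algebra F Fbar] [Algebra K Fbar] {E : WeierstrassCurve F} [E.IsElliptic] {l : ℕ}
  {Pb : BadPlacePredicates K} (D : InitialThetaData F K Fbar E l Pb) {logvK : PadicLogsVal K}
  (hlog : LogvAnalyticVal logvK) (r : ThetaData.IdeleData D)
  (M : Type) [Field M] [NumberField M]
  (archPk : ∀ (j : (thetaIndexOfInitial D).Label) (vQ : (thetaIndexOfInitial D).VQ),
    Set ((logShellsOfInitialDH D logvK).Packet j vQ))
  (archSub : ∀ (j : (thetaIndexOfInitial D).Label) (v : (thetaIndexOfInitial D).V),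
    Set ((logShellsOfInitialDH D logvK).Packet j ((thetaIndexOfInitial D).over v)))
  (Ψ : ℤ → ∀ v : (thetaIndexOfInitial D).V, v ∈ (thetaIndexOfInitial D).Vbad →
    Set ((logShellsOfInitialDH D logvK).StarPacket v))
  (act : ℤ → ∀ v : (thetaIndexOfInitial D).V, v ∈ (thetaIndexOfInitial D).Vbad →
    (logShellsOfInitialDH D logvK).StarPacket v → Module.End ℚ ((logShellsOfInitialDH D logvK).StarPacket v))
  (Mmod : ℤ → ∀ j : (thetaIndexOfInitial D).LabelStar, Set ((logShellsOfInitialDH D logvK).GlobalPacket j.1))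
  (region : ℤ → ∀ j : (thetaIndexOfInitial D).LabelStar, FinDivisor M → ∀ vQ : (thetaIndexOfInitial D).VQ,
    Set ((logShellsOfInitialDH D logvK).Packet j.1 vQ))
  (n : ℤ) {HT : Type} {LogLink : HT → HT → Type} {IsFull : ∀ {s t : HT}, LogLink s t → Prop}
  (lat : LGPGaussianLogThetaLattice LogLink IsFull)
  {Frd : Type} {IsoF : Frd → Frd → Type} {Ob : Frd → Type} {realify : Frd → Frd} {Strip : Type}
  {IsoS : Strip → Strip → Type}
  {Mv : ∀ v : (thetaIndexOfInitial D).V, v ∈ (thetaIndexOfInitial D).Vbad → Type} [∀ v h, Monoid (Mv v h)]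
  (sig : GlobalLGPFrobenioidSignature (thetaIndexOfInitial D).lstar (thetaIndexOfInitial D).V
    (· ∈ (thetaIndexOfInitial D).Vbad) Frd IsoF Ob realify Strip IsoS Mv)
  (split : SplittingMonoids Mv) {ObΔ : Type}
  {N : ∀ v : (thetaIndexOfInitial D).V, v ∈ (thetaIndexOfInitial D).Vbad → Type} [∀ v h, Monoid (N v h)]
  (qData : QPilotData ObΔ N)
  (htq0 : ∀ (u : FinitePlace ℚ) (x : (thetaIndexOfInitial D).Fibre (Val.non u)),
    tqM D (ratChar u) u (natCast_ratChar_mem u) r x ≠ 0)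
  (Sq : Finset (FinitePlace ℚ))
  (htq1 : ∀ (u : FinitePlace ℚ) (x : (thetaIndexOfInitial D).Fibre (Val.non u)), u ∉ Sq →
    ‖tqM D (ratChar u) u (natCast_ratChar_mem u) r x‖ = 1)

/-- **OWN IDELES: `‖t_{Θ,i,x₀}‖ = ‖ϖ‖^{(i+1)²·m_q}` once `‖t_{q,x₀}‖ = ‖ϖ‖^{m_q}`** (p459746 / gen-5 `norm_tThetaM_eq_norm_tqM_pow`,
Dupuy–Hilado (3.4) `P_{Θ,j} = j²·P_q`). [cite: DupuyHilado2025, §3.3, §3.4, §3.9] -/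
theorem norm_tOfIdeleData_eq_zpow_of_norm_tqM (u : FinitePlace ℚ) (i : Fin (thetaIndexOfInitial D).lstar)
    (x₀ : (thetaIndexOfInitial D).Fibre (Val.non u)) {ϖ : (kOfM D (ratChar u) u (natCast_ratChar_mem u) x₀)ˣ} {mq : ℤ}
    (hq : ‖tqM D (ratChar u) u (natCast_ratChar_mem u) r x₀‖ = ‖(ϖ : kOfM D (ratChar u) u (natCast_ratChar_mem u) x₀)‖ ^ mq) :
    ‖tOfIdeleData D r u i x₀‖ =
      ‖(ϖ : kOfM D (ratChar u) u (natCast_ratChar_mem u) x₀)‖ ^ (mq * ((((i : ℕ) + 1) ^ 2 : ℕ) : ℤ)) := by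
  rw [show ‖tOfIdeleData D r u i x₀‖ = ‖tqM D (ratChar u) u (natCast_ratChar_mem u) r x₀‖ ^ (((i : ℕ) + 1) ^ 2) from
    norm_tThetaM_eq_norm_tqM_pow D r (ratChar u) u (natCast_ratChar_mem u) i x₀, hq, ← zpow_natCast, ← zpow_mul]

/-- **OWN IDELES, ANY LOCAL TYPE: one place violating the orders predicate with `M = (i+1)²·m_q` refutes the licence at the own-ideles M
setting** (the `hSHw` / `hNumOffBad_M` clause of the M-line certificates of record for the q-pinned reading; uniformiser `ϖ`, `d = D/e`,
radii `‖cin₀‖ = ‖ϖ‖^{R_in}`, `‖cout₀‖ = ‖ϖ‖^{R_out}`, `‖t_{q,x₀}‖ = ‖ϖ‖^{m_q}` at ONE member `x₀`):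
`m_q < e·(((i+1)²·m_q − (i+1)·D − (i+2)·R_in) / e) + (i+2)·R_out ⟹ ¬ Licence`. [cite: Mochizuki2012, IUTchIII Cor. 3.12 Step (xi-f) p. 184;
IUTchIV Prop. 1.2 (i)(ii) p. 10] [cite: DupuyHilado2025, §3.4, §4.9, §4.12] -/
theorem not_licence_settingPrVolSharpM_tOfIdeleData_of_orders
    (u : FinitePlace ℚ) (i : Fin (thetaIndexOfInitial D).lstar) (x₀ : (thetaIndexOfInitial D).Fibre (Val.non u))
    {ϖ : (kOfM D (ratChar u) u (natCast_ratChar_mem u) x₀)ˣ} (hϖ : IsUniformizer ϖ) {Dx : ℕ}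
    (hD : differentOrd (ratChar u) (kOfM D (ratChar u) u (natCast_ratChar_mem u) x₀) =
      (Dx : ℝ) / absRamificationIdx (ratChar u) (kOfM D (ratChar u) u (natCast_ratChar_mem u) x₀))
    {cin₀ cout₀ : kOfM D (ratChar u) u (natCast_ratChar_mem u) x₀}
    (hin : ∀ o : kOfM D (ratChar u) u (natCast_ratChar_mem u) x₀, ‖o‖ ≤ 1 →
      cin₀ * o ∈ logUnits (kOfM D (ratChar u) u (natCast_ratChar_mem u) x₀))
    (hmax : ∃ (ϖ' : (kOfM D (ratChar u) u (natCast_ratChar_mem u) x₀)ˣ) (w : kOfM D (ratChar u) u (natCast_ratChar_mem u) x₀),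
      IsUniformizer ϖ' ∧ w ∉ logUnits (kOfM D (ratChar u) u (natCast_ratChar_mem u) x₀) ∧
        ‖w‖ * ‖(ϖ' : kOfM D (ratChar u) u (natCast_ratChar_mem u) x₀)‖ ≤ ‖cin₀‖)
    (houtΛ : cout₀ ∈ logUnits (kOfM D (ratChar u) u (natCast_ratChar_mem u) x₀))
    (hdom : ∀ z ∈ logUnits (kOfM D (ratChar u) u (natCast_ratChar_mem u) x₀), ‖z‖ ≤ ‖cout₀‖)
    {Rin Rout mq : ℤ} (hRin : ‖cin₀‖ = ‖(ϖ : kOfM D (ratChar u) u (natCast_ratChar_mem u) x₀)‖ ^ Rin)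
    (hRout : ‖cout₀‖ = ‖(ϖ : kOfM D (ratChar u) u (natCast_ratChar_mem u) x₀)‖ ^ Rout)
    (hq : ‖tqM D (ratChar u) u (natCast_ratChar_mem u) r x₀‖ = ‖(ϖ : kOfM D (ratChar u) u (natCast_ratChar_mem u) x₀)‖ ^ mq)
    (hlt : mq < (absRamificationIdx (ratChar u) (kOfM D (ratChar u) u (natCast_ratChar_mem u) x₀) : ℤ) *
        ((mq * ((((i : ℕ) + 1) ^ 2 : ℕ) : ℤ) - ((i : ℕ) + 1 : ℕ) * (Dx : ℤ) - ((i : ℕ) + 2 : ℕ) * Rin) /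
          (absRamificationIdx (ratChar u) (kOfM D (ratChar u) u (natCast_ratChar_mem u) x₀) : ℤ)) +
      ((i : ℕ) + 2 : ℕ) * Rout) :
    ¬ Thm311ToCor312.Licence
      (settingPrVolSharpM D hlog (tOfIdeleData D r) (fun u x => tqM D (ratChar u) u (natCast_ratChar_mem u) r x) M archPk archSub Ψ
        act Mmod region n lat sig split qData htq0 Sq htq1) :=
  not_licence_settingPrVolSharpM_of_orders D hlog (tOfIdeleData D r) (fun u x => tqM D (ratChar u) u (natCast_ratChar_mem u) r x) M
    archPk archSub Ψ act Mmod region n lat sig split qData htq0 Sq htq1 (tOfIdeleData_ne_zero D r) u i x₀ hϖ hD hin hmax houtΛ hdom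
    hRin hRout (norm_tOfIdeleData_eq_zpow_of_norm_tqM D r u i x₀ hq) hq hlt

/-- **OWN IDELES, TAME MEMBER** (`p_u > 2`, `e(K_{x₀}/ℚ_p) ≤ p_u − 2`, `‖t_{q,x₀}‖ = ‖ϖ‖^{m_q}`):
`m_q < e·(((i+1)²·m_q − 1)/e) + 1 − (i+1)·(e − 1) ⟹ ¬ Licence` — the M twin, refutation direction, of abc-iut-w5-d009's genuine-`K`
tame decider `licence_settingPrVolSharp_pilotDataOfK_iff_of_tame` (p449282; there `m_q = P_w`, both directions via the K-setting movers).
[cite: Mochizuki2012, IUTchIV Prop. 1.2 (i)(ii)(iii) p. 10–11; IUTchIII Cor. 3.12 Step (xi-f) p. 184] [cite: DupuyHilado2025, §3.3, §3.4, §4.9] -/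
theorem not_licence_settingPrVolSharpM_tOfIdeleData_of_tame_orders
    (u : FinitePlace ℚ) (i : Fin (thetaIndexOfInitial D).lstar) (x₀ : (thetaIndexOfInitial D).Fibre (Val.non u))
    (hp2 : 2 < ratChar u)
    (he : absRamificationIdx (ratChar u) (kOfM D (ratChar u) u (natCast_ratChar_mem u) x₀) ≤ ratChar u - 2)
    {ϖ : (kOfM D (ratChar u) u (natCast_ratChar_mem u) x₀)ˣ} (hϖ : IsUniformizer ϖ) {mq : ℤ}
    (hq : ‖tqM D (ratChar u) u (natCast_ratChar_mem u) r x₀‖ = ‖(ϖ : kOfM D (ratChar u) u (natCast_ratChar_mem u) x₀)‖ ^ mq)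
    (hlt : mq < (absRamificationIdx (ratChar u) (kOfM D (ratChar u) u (natCast_ratChar_mem u) x₀) : ℤ) *
        ((mq * ((((i : ℕ) + 1) ^ 2 : ℕ) : ℤ) - 1) / (absRamificationIdx (ratChar u) (kOfM D (ratChar u) u (natCast_ratChar_mem u) x₀) : ℤ)) +
        1 - ((i : ℤ) + 1) * ((absRamificationIdx (ratChar u) (kOfM D (ratChar u) u (natCast_ratChar_mem u) x₀) : ℤ) - 1)) :
    ¬ Thm311ToCor312.Licence
      (settingPrVolSharpM D hlog (tOfIdeleData D r) (fun u x => tqM D (ratChar u) u (natCast_ratChar_mem u) r x) M archPk archSub Ψ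
        act Mmod region n lat sig split qData htq0 Sq htq1) :=
  not_licence_settingPrVolSharpM_of_tame_orders D hlog (tOfIdeleData D r) (fun u x => tqM D (ratChar u) u (natCast_ratChar_mem u) r x)
    M archPk archSub Ψ act Mmod region n lat sig split qData htq0 Sq htq1 (tOfIdeleData_ne_zero D r) u i x₀ hp2 he hϖ
    (norm_tOfIdeleData_eq_zpow_of_norm_tqM D r u i x₀ hq) hq hlt

/-- **OWN IDELES, SINGLETON FIBRES EVERYWHERE: THE LICENCE DECIDED EXACTLY** (e.g. `F_mod = ℚ`: one member `x₀(u)` of `V̲` over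
every rational prime). Witnesses per `u` at `x₀(u)`: uniformiser `ϖ_u`, `d = D_u/e_u`, radii `‖cin(u)‖ = ‖ϖ_u‖^{R_in(u)}`,
`‖cout(u)‖ = ‖ϖ_u‖^{R_out(u)}`, and ONE integer per place with `‖t_{q,x₀(u)}‖ = ‖ϖ_u‖^{m_q(u)}` (`m_q(u) = 0` off the bad members, where the
predicate is then automatic, `orders_predicate_of_exponents_zero`). THEN `Thm311ToCor312.Licence` at the own-ideles M setting holds **iff**
`∀ u i, e_u·(((i+1)²·m_q(u) − (i+1)·D_u − (i+2)·R_in(u)) / e_u) + (i+2)·R_out(u) ≤ m_q(u)`. [cite: Mochizuki2012, IUTchIII Cor. 3.12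
p. 173–174, Step (xi-f) p. 184; IUTchIV Prop. 1.2 (i)(ii) p. 10] [cite: DupuyHilado2025, §3.3, §3.4, §4.9, §4.12] -/
theorem licence_settingPrVolSharpM_tOfIdeleData_iff_orders_of_forall_eq
    (x₀ : ∀ u : FinitePlace ℚ, (thetaIndexOfInitial D).Fibre (Val.non u))
    (hx : ∀ (u : FinitePlace ℚ) (x : (thetaIndexOfInitial D).Fibre (Val.non u)), x = x₀ u)
    (ϖ : ∀ u : FinitePlace ℚ, (kOfM D (ratChar u) u (natCast_ratChar_mem u) (x₀ u))ˣ) (hϖ : ∀ u, IsUniformizer (ϖ u))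
    (Dx : FinitePlace ℚ → ℕ)
    (hD : ∀ u, differentOrd (ratChar u) (kOfM D (ratChar u) u (natCast_ratChar_mem u) (x₀ u)) =
      (Dx u : ℝ) / absRamificationIdx (ratChar u) (kOfM D (ratChar u) u (natCast_ratChar_mem u) (x₀ u)))
    (cin cout : ∀ u : FinitePlace ℚ, kOfM D (ratChar u) u (natCast_ratChar_mem u) (x₀ u))
    (hin : ∀ u (o : kOfM D (ratChar u) u (natCast_ratChar_mem u) (x₀ u)), ‖o‖ ≤ 1 →
      cin u * o ∈ logUnits (kOfM D (ratChar u) u (natCast_ratChar_mem u) (x₀ u)))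
    (hmax : ∀ u, ∃ (ϖ' : (kOfM D (ratChar u) u (natCast_ratChar_mem u) (x₀ u))ˣ)
      (w : kOfM D (ratChar u) u (natCast_ratChar_mem u) (x₀ u)),
      IsUniformizer ϖ' ∧ w ∉ logUnits (kOfM D (ratChar u) u (natCast_ratChar_mem u) (x₀ u)) ∧
        ‖w‖ * ‖(ϖ' : kOfM D (ratChar u) u (natCast_ratChar_mem u) (x₀ u))‖ ≤ ‖cin u‖)
    (houtΛ : ∀ u, cout u ∈ logUnits (kOfM D (ratChar u) u (natCast_ratChar_mem u) (x₀ u)))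
    (hdom : ∀ u, ∀ z ∈ logUnits (kOfM D (ratChar u) u (natCast_ratChar_mem u) (x₀ u)), ‖z‖ ≤ ‖cout u‖)
    (Rin Rout : FinitePlace ℚ → ℤ)
    (hRin : ∀ u, ‖cin u‖ = ‖(ϖ u : kOfM D (ratChar u) u (natCast_ratChar_mem u) (x₀ u))‖ ^ Rin u)
    (hRout : ∀ u, ‖cout u‖ = ‖(ϖ u : kOfM D (ratChar u) u (natCast_ratChar_mem u) (x₀ u))‖ ^ Rout u)
    (mq : FinitePlace ℚ → ℤ)
    (hq : ∀ u, ‖tqM D (ratChar u) u (natCast_ratChar_mem u) r (x₀ u)‖ =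
      ‖(ϖ u : kOfM D (ratChar u) u (natCast_ratChar_mem u) (x₀ u))‖ ^ mq u) :
    Thm311ToCor312.Licence
        (settingPrVolSharpM D hlog (tOfIdeleData D r) (fun u x => tqM D (ratChar u) u (natCast_ratChar_mem u) r x) M archPk archSub
          Ψ act Mmod region n lat sig split qData htq0 Sq htq1) ↔
      ∀ (u : FinitePlace ℚ) (i : Fin (thetaIndexOfInitial D).lstar),
        (absRamificationIdx (ratChar u) (kOfM D (ratChar u) u (natCast_ratChar_mem u) (x₀ u)) : ℤ) *
            ((mq u * ((((i : ℕ) + 1) ^ 2 : ℕ) : ℤ) - ((i : ℕ) + 1 : ℕ) * (Dx u : ℤ) - ((i : ℕ) + 2 : ℕ) * Rin u) /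
              (absRamificationIdx (ratChar u) (kOfM D (ratChar u) u (natCast_ratChar_mem u) (x₀ u)) : ℤ)) +
          ((i : ℕ) + 2 : ℕ) * Rout u ≤ mq u :=
  licence_settingPrVolSharpM_iff_orders_of_forall_eq D hlog (tOfIdeleData D r)
    (fun u x => tqM D (ratChar u) u (natCast_ratChar_mem u) r x) M archPk archSub Ψ act Mmod region n lat sig split qData htq0 Sq
    htq1 (tOfIdeleData_ne_zero D r) x₀ hx ϖ hϖ Dx hD cin cout hin hmax houtΛ hdom Rin Rout hRin hRout
    (fun u i => mq u * ((((i : ℕ) + 1) ^ 2 : ℕ) : ℤ)) mq (fun u i => norm_tOfIdeleData_eq_zpow_of_norm_tqM D r u i (x₀ u) (hq u)) hq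

end Summit.ABC.IUTFork.Thm311.Real

end
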